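import Summits.PneNP.PneNP.Theorems.NegLimitedHalfWindowDefs
import Mathlib
import HarnessLib

/-!
# Route NegLimited — line `half-window`, stub N part 1: the tribes calibration `mCal` and the first term
(rung F-N1/p3, ROUND-13; item stmt-PneNP-19888 `NegLimited.NeglimitedHalfLogNegationsR`, registered skeleton
`half-window`; card HOME/pnp-ideate-p3/r13/half-window.md, blueprint r13/BLUEPRINT-R2.md §N)

Elementary real analysis of the TREE's calibration (`NegLimitedHalfWindowDefs` p488409)
`mCal w = ⌊Σ_{j=1}^{w} 2^{w−j}/j⌋ = ⌊2^w · S_w⌋`, `S_w = Σ_{i<w} 2^{-(i+1)}/(i+1)`: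
* `cast_mCal_sum` (the `ℚ`-sum cast to `ℝ` is `2^w · S_w`), `abs_partialLogTwo_sub_log_two_le`
  (`|S_w − log 2| ≤ 2^{-w}`, Mathlib's log-series remainder `Real.abs_log_sub_add_sum_range_le`),
  `cast_mCal_le` / `lt_mCal_add_one` (floor brackets), `mCal_mul_le_one` (`mCal w · 2^{-w} ≤ 1`);
* FIRST TERM `first_term_le`: with `L = −mCal w · log(1 − 2^{-w})` one has `|L − log 2| ≤ 4·2^{-w}`, so
  `|1 − 2(1−2^{-w})^{mCal w}| = |1 − e^{log 2 − L}| ≤ 8·2^{-w}` for `w ≥ 2` (`Real.abs_exp_sub_one_sub_id_le`).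
The stub `stub_tribesNumericsCal` itself is in `NegLimitedHalfWindowTribesNumerics.lean`.

References: R. O'Donnell, *Hardness amplification within NP*, JCSS 69 (2004), §3 (calibration of tribes:
`m ≈ 2^w ln 2`) [ODonnell2004]; cell record HOME/pnp-ideate-p3/ROUND-13.md §2.

HONEST FRAMING: bookkeeping for ONE registered stub of an OPEN rung item; FRONTIER rung F-N1 — nothing here bears on
P vs NP.
-/

set_option linter.dupNamespace false -- `Summit.PneNP.PneNP.…`: summit = sub-problem name (D-0017 single-conjunct layout)

namespace Summit.PneNP.PneNP.Theorems.NegLimitedHalfWindow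

open Finset Filter
open Summit.PneNP.PneNP.Theorems.NegLimitedAmplifiedWindow (biasSeq biasSeq_mem biasSeq_decay)

/-! ## The calibration `mCal w = ⌊2^w · S_w⌋`, `S_w = Σ_{i<w} 2^{-(i+1)}/(i+1)` -/

/-- The rational defining sum of `mCal`, cast to `ℝ`, is `2^w · Σ_{i<w} 2^{-(i+1)}/(i+1)`. -/
theorem cast_mCal_sum (w : ℕ) :
    ((∑ j ∈ Finset.Icc 1 w, (2 : ℚ) ^ (w - j) / (j : ℚ) : ℚ) : ℝ) =
      (2 : ℝ) ^ w * ∑ i ∈ Finset.range w, ((1 : ℝ) / 2) ^ (i + 1) / ((i : ℝ) + 1) := by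
  push_cast
  rw [← Finset.Ico_add_one_right_eq_Icc, Finset.sum_Ico_eq_sum_range, Nat.add_sub_cancel, Finset.mul_sum]
  refine Finset.sum_congr rfl fun i hi => ?_
  rw [Finset.mem_range] at hi
  have hpow : (2 : ℝ) ^ (w - (1 + i)) * 2 ^ (i + 1) = 2 ^ w := by
    rw [← pow_add]; congr 1; omega
  have h2 : (2 : ℝ) ^ (i + 1) ≠ 0 := by positivity
  have hpow' : (2 : ℝ) ^ (w - (1 + i)) = 2 ^ w / 2 ^ (i + 1) := eq_div_of_mul_eq h2 hpow
  rw [hpow', one_div_pow]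
  push_cast
  ring

/-- `|S_w − log 2| ≤ 2^{-w}` (remainder of the series `log 2 = Σ_{i≥0} 2^{-(i+1)}/(i+1)`). -/
theorem abs_partialLogTwo_sub_log_two_le (w : ℕ) :
    |(∑ i ∈ Finset.range w, ((1 : ℝ) / 2) ^ (i + 1) / ((i : ℝ) + 1)) - Real.log 2| ≤ ((1 : ℝ) / 2) ^ w := by
  have h := Real.abs_log_sub_add_sum_range_le (x := (1 : ℝ) / 2) (by rw [abs_of_pos (by norm_num)]; norm_num) w
  have habs : |(1 : ℝ) / 2| = 1 / 2 := abs_of_pos (by norm_num)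
  have hlog : Real.log (1 - 1 / 2) = -Real.log 2 := by
    rw [show (1 : ℝ) - 1 / 2 = 2⁻¹ by norm_num, Real.log_inv]
  have hrem : ((1 : ℝ) / 2) ^ (w + 1) / (1 - 1 / 2) = ((1 : ℝ) / 2) ^ w := by rw [pow_succ]; ring
  rw [habs, hlog, hrem, ← sub_eq_add_neg] at h
  exact h

/-- The defining rational of `mCal w` is nonnegative. -/
theorem mCal_sum_nonneg (w : ℕ) : (0 : ℚ) ≤ ∑ j ∈ Finset.Icc 1 w, (2 : ℚ) ^ (w - j) / (j : ℚ) :=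
  Finset.sum_nonneg fun j _ => by positivity

/-- `mCal w ≤ 2^w · S_w`. -/
theorem cast_mCal_le (w : ℕ) :
    (mCal w : ℝ) ≤ (2 : ℝ) ^ w * ∑ i ∈ Finset.range w, ((1 : ℝ) / 2) ^ (i + 1) / ((i : ℝ) + 1) := by
  have h1 : ((mCal w : ℕ) : ℚ) ≤ ∑ j ∈ Finset.Icc 1 w, (2 : ℚ) ^ (w - j) / (j : ℚ) := Nat.floor_le (mCal_sum_nonneg w)
  have h2 := Rat.cast_le (K := ℝ).mpr h1
  rw [Rat.cast_natCast, cast_mCal_sum] at h2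
  exact h2

/-- `2^w · S_w < mCal w + 1`. -/
theorem lt_mCal_add_one (w : ℕ) :
    (2 : ℝ) ^ w * ∑ i ∈ Finset.range w, ((1 : ℝ) / 2) ^ (i + 1) / ((i : ℝ) + 1) < (mCal w : ℝ) + 1 := by
  have h1 : (∑ j ∈ Finset.Icc 1 w, (2 : ℚ) ^ (w - j) / (j : ℚ)) < ((mCal w : ℕ) : ℚ) + 1 := Nat.lt_floor_add_one _
  have h2 := Rat.cast_lt (K := ℝ).mpr h1
  rw [cast_mCal_sum] at h2
  push_cast at h2
  exact h2

/-- `mCal w · 2^{-w} ≤ 1` (indeed `≤ S_w ≤ log 2 + 2^{-w} < 1` for `w ≥ 2`). -/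
theorem mCal_mul_le_one {w : ℕ} (hw : 2 ≤ w) : (mCal w : ℝ) * ((1 : ℝ) / 2) ^ w ≤ 1 := by
  have hS := abs_partialLogTwo_sub_log_two_le w
  have hm := cast_mCal_le w
  have hc4 : ((1 : ℝ) / 2) ^ w ≤ 1 / 4 := by
    calc ((1 : ℝ) / 2) ^ w ≤ ((1 : ℝ) / 2) ^ 2 := pow_le_pow_of_le_one (by norm_num) (by norm_num) hw
      _ = 1 / 4 := by norm_num
  have hone : (2 : ℝ) ^ w * ((1 : ℝ) / 2) ^ w = 1 := by rw [← mul_pow]; norm_num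
  have hSle : ∑ i ∈ Finset.range w, ((1 : ℝ) / 2) ^ (i + 1) / ((i : ℝ) + 1) ≤ Real.log 2 + ((1 : ℝ) / 2) ^ w := by
    have := (abs_le.mp hS).2; linarith
  have hpos : (0 : ℝ) < ((1 : ℝ) / 2) ^ w := by positivity
  calc (mCal w : ℝ) * ((1 : ℝ) / 2) ^ w
      ≤ ((2 : ℝ) ^ w * ∑ i ∈ Finset.range w, ((1 : ℝ) / 2) ^ (i + 1) / ((i : ℝ) + 1)) * ((1 : ℝ) / 2) ^ w :=
        mul_le_mul_of_nonneg_right hm hpos.le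
    _ = ∑ i ∈ Finset.range w, ((1 : ℝ) / 2) ^ (i + 1) / ((i : ℝ) + 1) := by
        rw [mul_comm ((2 : ℝ) ^ w), mul_assoc, hone, mul_one]
    _ ≤ 1 := by linarith [Real.log_two_lt_d9]

/-! ## The first term `|1 − 2(1 − 2^{-w})^{mCal w}| ≤ 8·2^{-w}` -/

/-- **First term.** -/
theorem first_term_le {w : ℕ} (hw : 2 ≤ w) :
    |1 - 2 * (1 - ((1 : ℝ) / 2) ^ w) ^ mCal w| ≤ 8 * ((1 : ℝ) / 2) ^ w := by
  set c : ℝ := ((1 : ℝ) / 2) ^ w with hc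
  set S : ℝ := ∑ i ∈ Finset.range w, ((1 : ℝ) / 2) ^ (i + 1) / ((i : ℝ) + 1) with hSdef
  set m : ℕ := mCal w with hmdef
  have hc0 : 0 < c := by positivity
  have hc4 : c ≤ 1 / 4 := by
    calc c = ((1 : ℝ) / 2) ^ w := hc
      _ ≤ ((1 : ℝ) / 2) ^ 2 := pow_le_pow_of_le_one (by norm_num) (by norm_num) hw
      _ = 1 / 4 := by norm_num
  have hone : (2 : ℝ) ^ w * c = 1 := by rw [hc, ← mul_pow]; norm_num
  -- calibration brackets
  have hS := abs_partialLogTwo_sub_log_two_le w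
  rw [← hSdef, ← hc] at hS
  obtain ⟨hS1, hS2⟩ := abs_le.mp hS
  have hm1 : (m : ℝ) * c ≤ S := by
    have h := mul_le_mul_of_nonneg_right (cast_mCal_le w) hc0.le
    rw [← hSdef, ← hmdef, mul_comm ((2 : ℝ) ^ w), mul_assoc, hone, mul_one] at h
    exact h
  have hm2 : S - c < (m : ℝ) * c := by
    have h := mul_lt_mul_of_pos_right (lt_mCal_add_one w) hc0
    rw [← hSdef, ← hmdef, mul_comm ((2 : ℝ) ^ w), mul_assoc, hone, mul_one, add_mul, one_mul] at h
    linarith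
  -- the logarithm `l = -log(1 - c) ∈ [c, c + 2c²]`
  have h1c : 0 < 1 - c := by linarith
  have hl1 : c ≤ -Real.log (1 - c) := by
    have := Real.log_le_sub_one_of_pos h1c; linarith
  have hl2 : -Real.log (1 - c) ≤ c + 2 * c ^ 2 := by
    have h := Real.abs_log_sub_add_sum_range_le (x := c) (by rw [abs_of_pos hc0]; linarith) 1
    rw [abs_of_pos hc0, Finset.sum_range_one] at h
    norm_num at h
    have h' := (abs_le.mp h).1
    have hden : c ^ 2 / (1 - c) ≤ 2 * c ^ 2 := by
      rw [div_le_iff₀ h1c]; nlinarith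
    linarith
  -- `L = m·l` is within `4c` of `log 2`
  have hm0 : (0 : ℝ) ≤ m := Nat.cast_nonneg _
  have hL1 : (m : ℝ) * (-Real.log (1 - c)) ≤ Real.log 2 + 4 * c := by
    have h := mul_le_mul_of_nonneg_left hl2 hm0
    have hlog2 := Real.log_two_lt_d9
    have hmc : (m : ℝ) * (c + 2 * c ^ 2) = (m : ℝ) * c * (1 + 2 * c) := by ring
    rw [hmc] at h
    have hmc2 : (m : ℝ) * c ≤ Real.log 2 + c := by linarith
    have h3 : (m : ℝ) * c * (1 + 2 * c) ≤ (Real.log 2 + c) * (1 + 2 * c) :=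
      mul_le_mul_of_nonneg_right hmc2 (by linarith)
    nlinarith
  have hL2 : Real.log 2 - 2 * c ≤ (m : ℝ) * (-Real.log (1 - c)) := by
    have h := mul_le_mul_of_nonneg_left hl1 hm0
    linarith
  -- `2(1-c)^m = exp (log 2 - L)`
  set t : ℝ := Real.log 2 - (m : ℝ) * (-Real.log (1 - c)) with ht
  have hexp : 2 * (1 - c) ^ m = Real.exp t := by
    have h1 : t = Real.log 2 + (m : ℝ) * Real.log (1 - c) := by rw [ht]; ring
    rw [h1, Real.exp_add, Real.exp_log (by norm_num : (0 : ℝ) < 2), ← Real.log_pow, Real.exp_log (pow_pos h1c m)]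
  have htabs : |t| ≤ 4 * c := by
    rw [abs_le]; constructor <;> linarith
  have ht1 : |t| ≤ 1 := by linarith
  have hE := Real.abs_exp_sub_one_sub_id_le ht1
  -- `|1 - exp t| ≤ |t| + t² ≤ 2|t| ≤ 8c`
  have hsq : t ^ 2 ≤ |t| := by
    rw [← sq_abs]; nlinarith [abs_nonneg t]
  rw [hexp, abs_sub_comm]
  have htri : |Real.exp t - 1| ≤ |Real.exp t - 1 - t| + |t| := by
    have := abs_add_le (Real.exp t - 1 - t) t
    rwa [sub_add_cancel] at this
  linarith

end Summit.PneNP.PneNP.Theorems.NegLimitedHalfWindow
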